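import Summits.QuantumFields.BalabanUV.T4Continuum.Spine.NE7c.LiveFactorKappaInduction
import Summits.QuantumFields.BalabanUV.T4Continuum.Spine.NE7c.LiveFactorCouplingConvention
import Literature.MathematicalPhysics.QuantumFieldTheory.Balaban1983to89.T4PersistentHistoryCount

/-!
# `T4Continuum.Spine.NE7c.LiveFactorJointClause` — spine estimate NE7c (node U5b), road (δ) THRESHOLD RANDOMISATION:
# the located «p₀ large ∕ g small» clauses that SEE the live factor's floor `λ₀` — [B16] p. 381 (`4 ≦ γ₀A₁²p₀(g_j)`),
# p. 383 (the exponent proviso's margin), p. 385 (the located condition of the κ-induction), p. 387 (the merger's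
# budget «for p₀ large and γ small enough», through the C8 shift of the cost constant) and the restriction-tail
# clause of the C8∕C5′ leaves — hold SIMULTANEOUSLY below ONE explicit `g⋆(λ₀; print's constants)`, every other
# constant being fixed BEFORE `g` (print's order: «γ sufficiently small» last).  Apex of the seat's four files
# (cell `pub-balaban-gaps`, track G2, seat ne8 gen 4; record `HOME/ne/NE7c.md` §11)

HONEST FRAMING.  Finite four-torus programme, rung (B)+1 only — NOT infinite volume, NOT a mass gap, NOT the Clay
problem, NOT summit progress, NOT a proof of NE7c (`T4IndicatorShell.ShellWeightBound`, INSTANCE 0∕1, which waits on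
node O).  Nothing of [Bałaban 1983–89] is asserted beyond print: the inputs are the explicit hypotheses of the tree's
quoted leaves as consumed by the companions (`…Spine.NE7c.LiveFactorLargeField` p340750, `…LiveFactorRestrictedGaussian`
p340806, `…LiveFactorKappaInduction` p342544, `…LiveFactorCouplingConvention` p342610), and what is PROVED is real
arithmetic: finitely many clauses of the shape `W·ℓ^n ≦ K·ℓ^m` (`ℓ = log g⁻²`, `n < m`) hold together beyond the largest
of their explicit thresholds.  This file does NOT verify that these are ALL the clauses of [B14]–[B16] that see a live
threshold (the completeness of the (L1-step) census is NOT PRINTED, GAPS G-ne7cp1-2; the cell's two-reader census is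
`HOME/ne/NE7c.md` §7∕§9∕§10∕§11).  Spine PROVED 0∕9 — unchanged by this file.

WHY THIS LEAF (the census's sentence «both «g small» clauses asked ONCE at λ₀» made one theorem, and the Edison item
«are road (δ)'s located clauses JOINTLY satisfiable in print's order of constants?» answered WITH A RESULT).  Road (δ)
(member (δ-1) of `Lit.T4ShellMeasure` §8e) lowers every LIVE small-field threshold of one run by a common factor
`λ ∈ [λ₀, 1]`, `λ₀ = 1 − β′ > 0`; in the [III] (2.2)–(2.4) dictionary this is `(A₀, A₁) ↦ (μA₀, μA₁)`, `μ ∈ [λ₀, 1]` per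
threshold.  The companions proved that every kept factor ∕ bound of [B16] §1 survives VERBATIM in `p₀(g_j)` provided
finitely many printed «p₀ large, g_j small» clauses are re-asked with `A₁ ↦ λ₀A₁` — and, for the threshold-RESTRICTED
normalisations (class C8), with print's cost constant `O(1)` shifted to `O(1) + k·log λ₀⁻¹` (Jacobian form,
`restrictedGaussian_lower_live`) or with one Gaussian-tail clause at `λ₀` (tail form, `restrictedMass_lower_live`; also
the C5′ size lemma `restrictedMean_mismatch_live`).  Each companion delivered ITS clause below ITS OWN `g₀(λ₀, …)`.  The
(α)-instance (node O) will need all of them AT ONCE along one run whose couplings obey `0 < g_k ≦ γ`: this file states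
the conjunction below ONE `g⋆` and exhibits the quantifier order — `L, r, p₀, p₁, d` (geometry ∕ exponents, with the
STRICT proviso «2p₁ − (d + 5)r₀ > p₀» of p. 383 and «p₁ < p₀» of [B15] p. 183), the amplitudes `A₀, A₁, γ₀`, the cost ∕
overshoot constants of (1.80)–(1.88), the restriction data (`M₀`, variance `v`, bonds per cube `n_B`, target amplitude),
the slack `λ₀` (road (δ)'s design constant, owing nothing to print; the C8-shifted cost constants may depend on it) — all
universally quantified — THEN `∃ g⋆ > 0`, `∀ 0 < g ≦ g⋆`.  RESULT: no
clause asks `g` large and none constrains `λ₀` beyond `0 < λ₀`; the clauses are jointly satisfiable with «γ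
sufficiently small» LAST, as in print ([B15] p. 186 «the conditions on M, γ, A₀, and A₁ introduced above do not depend
on any scale»; p. 185 ∕ p. 187 «if γ is sufficiently small»).  NEW relative to the companions: (iv) the merger's budget
condition (1.88) p. 387 (`Lit.B16Lem384Induction.MergeIndex.hbudget : E + cost(2) ≦ 2(1+β₀)⁻¹p₀(g_{j+1})`), which does
not see the amplitude `A₁` (p342544's reading) but DOES see `λ₀` through the C8 cost shift — priced here with ANY cost
constant `C′ ≥ 0` and overshoot `E₁R^{d+2}` under the room `(d + 2)r₀ < p₀`, itself implied by the p. 383 proviso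
(`budgetRoom_of_proviso383`); and (v) the abstract tail clause of p340806 ∕ p342610 written in print's letters
(`θ = M₀g⁻¹δ = M₀A₁(log g⁻²)^{p₀}`, [B16] (1.2) «χ({|B′| < M₀g_k⁻¹δ_k})», [III] (2.3) `δ_k = g_kA₁(log g_k⁻²)^{p₀}`), which
makes it a «g small» clause like the others.

WHAT IS HERE (all PROVED, [folklore] real arithmetic; `Lit.` = `Literature.MathematicalPhysics.QuantumFieldTheory.
Balaban1983to89`).
* §1 `powClause_of_ell_ge` (`W·ℓ^n ≦ K·ℓ^m` for `ℓ ≧ max 1 (W∕K)`, `n < m`), `costClause_of_g_small` (the same against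
  (2.5)'s `R ≦ Lℓ^{r₀}`: `W·R^n ≦ K·(log g⁻²)^m` below an explicit `g₀` once `n·r₀ < m`); `1 ≦ R` for (2.5)'s `R = L^s`
  is the landed `Lit.T4PersistentHistoryCount.one_le_cast_of_isRj`, cited BY NAME (the only use of that import).
* §2 `budgetRoom_of_proviso383` (`(d + 2)r₀ < p₀` ⇐ proviso + `p₁ ≦ p₀`), `budget188_of_g_small` (clause (iv)) and its
  form in the currency of `Lit.Step.Budget.Consts.cost` (`hbudget_of_g_small`).
* §3 `tailClause_of_g_small` (clause (v)).
* §4 HEADLINE `roadDelta_clauses_of_g_small`: clauses (i) p. 381, (ii) p. 383 (= p340750's `liveFactor383_of_g_small`,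
  uniformly in `μ ≥ λ₀`), (iii) p. 385 (= p342544's `locatedCondition385_of_g_small`, room from
  `exponentRoom_of_proviso383`), (iv) p. 387, (v) the tail clause — under ONE `g⋆ > 0`.
* §5 sanity: the binder list is jointly inhabited (`d = 4`, `p₀ = p₁ = 10`, `r₀ = 1`).
NOT HERE: node O, U1b's two-run rate, (W1), the absorption DESIGN of C5′, the identification of `C′`, `E₁`, `M₀`, `v`
with print's `O(1)`'s (node O's junction); no `def … : Prop` hypothesis is minted; 0 sorry.
-/

namespace Summit.QuantumFields.BalabanUV.T4Continuum.Spine.NE7c.LiveFactorJointClause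

open Literature.MathematicalPhysics.QuantumFieldTheory.Balaban1983to89
open B16Sect1Kernels
open Summit.QuantumFields.BalabanUV.T4Continuum.Spine.NE7c.LiveFactorLargeField
open Summit.QuantumFields.BalabanUV.T4Continuum.Spine.NE7c.LiveFactorKappaInduction

noncomputable section

/-! ## §1. The one arithmetic pattern behind every «p₀ large, g small» clause -/

/-- **THE PATTERN.**  A clause `W·ℓ^n ≦ K·ℓ^m` with `K > 0` and natural exponents `n < m` holds for every
`ℓ ≧ max 1 (W∕K)` («p₀ large» = the exponent room `n < m`; «g small» = `ℓ = log g⁻²` beyond the explicit threshold;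
no sign condition on `W` is needed). [folklore] -/
theorem powClause_of_ell_ge {W K ℓ : ℝ} {n m : ℕ} (hK : 0 < K) (hnm : n < m)
    (hℓ : max 1 (W / K) ≤ ℓ) : W * ℓ ^ n ≤ K * ℓ ^ m := by
  have hℓ1 : 1 ≤ ℓ := le_trans (le_max_left _ _) hℓ
  have hℓ0 : 0 ≤ ℓ := zero_le_one.trans hℓ1
  have hWK : W ≤ K * ℓ := by
    have h := le_trans (le_max_right _ _) hℓ
    rw [div_le_iff₀ hK] at h
    linarith [mul_comm ℓ K]
  have hpow : ℓ ^ (n + 1) ≤ ℓ ^ m := pow_le_pow_right₀ hℓ1 (by omega)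
  calc W * ℓ ^ n ≤ (K * ℓ) * ℓ ^ n := mul_le_mul_of_nonneg_right hWK (pow_nonneg hℓ0 n)
    _ = K * ℓ ^ (n + 1) := by ring
    _ ≤ K * ℓ ^ m := mul_le_mul_of_nonneg_left hpow hK.le

/-- **THE PATTERN AGAINST (2.5)'s BRACKET.**  For `R` given by (2.5) [III] (`Lit.B14.IsRj L r₀ g R`, `L ≥ 1`; hence
`R ≦ L(log g⁻²)^{r₀}`, `Lit.B16Sect1SmallFactors.dict_of_isRj`), a cost `W·R^n` (`W ≥ 0`) against a profile `K·(log g⁻²)^m`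
(`K > 0`) with the exponent room `n·r₀ < m`: there is `g₀ = exp(−½·max{1, WL^n∕K}) > 0` such that
`W·R^n ≦ K·(log g⁻²)^m` for all `0 < g ≦ g₀`.  (The companions' `locatedCondition385_of_g_small` is the instance
`n = d + 2`, `m = 2p₀`; §2's budget clause is `n = d + 2`, `m = p₀`.) [folklore] -/
theorem costClause_of_g_small {L r n m : ℕ} {W K : ℝ} (hL : 1 ≤ L) (hW : 0 ≤ W) (hK : 0 < K)
    (hroom : n * r < m) :
    ∃ g₀ : ℝ, 0 < g₀ ∧ ∀ (g : ℝ) (R : ℕ), 0 < g → g ≤ g₀ → B14.IsRj L r g R →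
      W * (R : ℝ) ^ n ≤ K * (Real.log (g ^ 2)⁻¹) ^ m := by
  have hL' : (1 : ℝ) ≤ (L : ℝ) := by exact_mod_cast hL
  have hL0 : (0 : ℝ) ≤ (L : ℝ) := zero_le_one.trans hL'
  set W' : ℝ := W * (L : ℝ) ^ n with hW'def
  set ℓ₀ : ℝ := max 1 (W' / K) with hℓ₀def
  refine ⟨Real.exp (-(ℓ₀ / 2)), Real.exp_pos _, fun g R hg0 hg hR => ?_⟩
  set ℓ : ℝ := Real.log (g ^ 2)⁻¹ with hℓdef
  have hℓ : ℓ₀ ≤ ℓ := B16Sect1SmallFactors.ell_ge_of_g_le hg0 hg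
  have hℓ1 : 1 ≤ ℓ := le_trans (le_max_left _ _) hℓ
  have hℓ0 : 0 ≤ ℓ := zero_le_one.trans hℓ1
  -- the (2.5) bracket `R ≤ L ℓ^{r₀}`
  obtain ⟨-, hRhi⟩ := B16Sect1SmallFactors.dict_of_isRj hL hR hℓ1
  rw [Real.rpow_natCast] at hRhi
  have hR0 : (0 : ℝ) ≤ (R : ℝ) := Nat.cast_nonneg R
  have hRn : (R : ℝ) ^ n ≤ (L : ℝ) ^ n * ℓ ^ (n * r) := by
    calc (R : ℝ) ^ n ≤ ((L : ℝ) * ℓ ^ r) ^ n := pow_le_pow_left₀ hR0 hRhi n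
      _ = (L : ℝ) ^ n * ℓ ^ (n * r) := by rw [mul_pow, ← pow_mul, mul_comm r n]
  -- the pattern with `W' = W L^n`
  have hmain : W' * ℓ ^ (n * r) ≤ K * ℓ ^ m := powClause_of_ell_ge hK hroom hℓ
  calc W * (R : ℝ) ^ n ≤ W * ((L : ℝ) ^ n * ℓ ^ (n * r)) := mul_le_mul_of_nonneg_left hRn hW
    _ = W' * ℓ ^ (n * r) := by rw [hW'def]; ring
    _ ≤ K * ℓ ^ m := hmain

/-! ## §2. Clause (iv): the merger's budget condition (1.88) p. 387, with the C8-shifted cost constant -/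

/-- **THE BUDGET ROOM IS PRINT'S.**  «for p₀ large»: comparing `p₀(g) ∝ (log g⁻²)^{p₀}` with the cost ∕ overshoot
`∝ R^{d+2} ≦ L^{d+2}(log g⁻²)^{(d+2)r₀}` ((2.5) [III]) needs `(d + 2)r₀ < p₀`; it is IMPLIED by the strict proviso of
p. 383 «2p₁ − (d + 5)r₀ > p₀» (`Lit.B16Sect1Kernels.ExponentProviso383`) and [B15] p. 183 «p₁ < p₀» (used as `p₁ ≦ p₀`):
`(d + 2)r₀ ≦ (d + 5)r₀ < 2p₁ − p₀ ≦ p₀`.  (The companion's `exponentRoom_of_proviso383` is the weaker room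
`(d + 2)r₀ < 2p₀` of the p. 385 condition, whose profile is SQUARED.)  No exponent condition beyond print's. [folklore] -/
theorem budgetRoom_of_proviso383 {p₀ p₁ r d : ℕ} (hprov : ExponentProviso383 p₀ p₁ r d) (hp : p₁ ≤ p₀) :
    (d + 2) * r < p₀ := by
  unfold ExponentProviso383 at hprov
  have hp' : (p₁ : ℝ) ≤ p₀ := by exact_mod_cast hp
  have hr : (0 : ℝ) ≤ r := Nat.cast_nonneg r
  have hd : (0 : ℝ) ≤ d := Nat.cast_nonneg d
  have h : ((d : ℝ) + 2) * r < p₀ := by nlinarith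
  exact_mod_cast h

/-- **[B16] (1.88) p. 387, the merger's located budget condition «for p₀ large and γ small enough», priced.**  In the
currency of `Lit.B16Lem384Induction.MergeIndex.hbudget` (`E + O(1)M^dR_{j+1}^{d+1}·2 ≦ 2(1+β₀)⁻¹p₀(g_{j+1})`,
`p₀(g) = A₀(log g⁻²)^{p₀}` = `Lit.p0Profile`): let the overshoot be `E = E₁·R^{d+2}` (print: `O(1)·(100M)^dR_{j+1}^{d+2}`,
`E₁ ≥ 0`) and the cost constant ANY `C′ ≥ 0` — under road (δ) with the Jacobian bookkeeping of class C8
(p340806 `restrictedGaussian_lower_live`) this is print's `O(1)` SHIFTED to `O(1) + k·log λ₀⁻¹` (census rows 16∕19: the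
restricted normalisations' «O(1) log g_j⁻²|Z_j|» joins the cost), i.e. the budget condition SEES the slack `λ₀` although
it does not see the amplitude `A₁`.  Under the room `(d + 2)r₀ < p₀` (`budgetRoom_of_proviso383`) there is
`g₀ = g₀(E₁, C′, M, A₀, β₀, L, d, r₀, p₀) > 0` — explicitly `exp(−½·max{1, (E₁ + 2C′M^d)L^{d+2}(1+β₀)∕(2A₀)})` — such that
the condition holds for all `0 < g ≦ g₀` and `R` by (2.5). [folklore] -/
theorem budget188_of_g_small {L r p₀ d : ℕ} {E₁ C' M A₀ β₀ : ℝ} (hL : 1 ≤ L) (hE : 0 ≤ E₁) (hC : 0 ≤ C')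
    (hM : 0 ≤ M) (hA₀ : 0 < A₀) (hβ : 0 ≤ β₀) (hroom : (d + 2) * r < p₀) :
    ∃ g₀ : ℝ, 0 < g₀ ∧ ∀ (g : ℝ) (R : ℕ), 0 < g → g ≤ g₀ → B14.IsRj L r g R →
      E₁ * (R : ℝ) ^ (d + 2) + C' * M ^ d * (R : ℝ) ^ (d + 1) * 2 ≤ 2 * (1 + β₀)⁻¹ * p0Profile A₀ p₀ g := by
  have hβ' : 0 < 1 + β₀ := by linarith
  have hK : (0 : ℝ) < 2 * (1 + β₀)⁻¹ * A₀ := by positivity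
  have hW : (0 : ℝ) ≤ E₁ + 2 * (C' * M ^ d) := by positivity
  obtain ⟨g₀, hg₀, h⟩ := costClause_of_g_small (n := d + 2) (m := p₀) hL hW hK hroom
  refine ⟨g₀, hg₀, fun g R hg0 hg hR => ?_⟩
  have hR1 : (1 : ℝ) ≤ (R : ℝ) := T4PersistentHistoryCount.one_le_cast_of_isRj hL hR
  have hR0 : (0 : ℝ) ≤ (R : ℝ) := zero_le_one.trans hR1
  have hRd : (R : ℝ) ^ (d + 1) ≤ (R : ℝ) ^ (d + 2) := pow_le_pow_right₀ hR1 (by omega)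
  have hCM : 0 ≤ C' * M ^ d := by positivity
  have h1 := h g R hg0 hg hR
  calc E₁ * (R : ℝ) ^ (d + 2) + C' * M ^ d * (R : ℝ) ^ (d + 1) * 2
      ≤ E₁ * (R : ℝ) ^ (d + 2) + C' * M ^ d * (R : ℝ) ^ (d + 2) * 2 := by
        have := mul_le_mul_of_nonneg_left hRd hCM
        linarith
    _ = (E₁ + 2 * (C' * M ^ d)) * (R : ℝ) ^ (d + 2) := by ring
    _ ≤ 2 * (1 + β₀)⁻¹ * A₀ * (Real.log (g ^ 2)⁻¹) ^ p₀ := h1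
    _ = 2 * (1 + β₀)⁻¹ * p0Profile A₀ p₀ g := by rw [p0Profile]; ring

/-- … in the literal currency of `Lit.Step.Budget.Consts.cost` (`cost b n s = C·M^d·R_n^{d+1}·s`, the summand of (1.80)):
for constants `b` with `b.C = C′ ≥ 0`, `b.M ≥ 0` and `b.R n = R` by (2.5), the field `hbudget` of a merger at scale `n`
with overshoot `E₁·R^{d+2}` holds below `g₀`. [folklore] -/
theorem hbudget_of_g_small (b : Step.Budget.Consts) {L r p₀ : ℕ} {E₁ A₀ β₀ : ℝ} (hL : 1 ≤ L) (hE : 0 ≤ E₁)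
    (hC : 0 ≤ b.C) (hM : 0 ≤ b.M) (hA₀ : 0 < A₀) (hβ : 0 ≤ β₀) (hroom : (b.d + 2) * r < p₀) :
    ∃ g₀ : ℝ, 0 < g₀ ∧ ∀ (g : ℝ) (R : ℕ) (n : ℕ), 0 < g → g ≤ g₀ → B14.IsRj L r g R → b.R n = (R : ℝ) →
      E₁ * (R : ℝ) ^ (b.d + 2) + b.cost n 2 ≤ 2 * (1 + β₀)⁻¹ * p0Profile A₀ p₀ g := by
  obtain ⟨g₀, hg₀, h⟩ := budget188_of_g_small (C' := b.C) (M := b.M) hL hE hC hM hA₀ hβ hroom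
  refine ⟨g₀, hg₀, fun g R n hg0 hg hR hbR => ?_⟩
  rw [Step.Budget.Consts.cost, hbR]
  exact h g R hg0 hg hR

/-! ## §3. Clause (v): the restriction-tail clause of the C8 ∕ C5′ leaves in print's letters -/

/-- **The tail clause «log(2n_B) + target ≦ λ₀²θ²∕(2v)» of p340806's `restrictedMass_lower_live` ∕ p342610's
`restrictedMean_mismatch_live`, as a «g small» clause.**  With print's restriction threshold for the unit fluctuation
variable, `θ = M₀g⁻¹δ = M₀·A₁(log g⁻²)^{p₀}` ([B16] (1.2) «χ({|B′| < M₀g_k⁻¹δ_k})», [III] (2.3); `θ = M₀·Lit.p0Profile A₁ p₀ g`),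
a variance bound `v > 0`, `n_B` variables per restriction and a target `T·(log g⁻²)^{p₀}` (any real `T`; `T = A₀` makes
the lost mass `≦ exp(−p₀(g))`, print's kept factor): for `p₀ ≥ 1` there is
`g₀ = exp(−½·max{1, (max{log(2n_B), 0} + T)·2v∕(λ₀²M₀²A₁²)}) > 0` below which the clause holds — ONE smallness of `g`
depending on the slack `λ₀` (and `M₀, A₁, v, n_B, T`) only. [folklore] -/
theorem tailClause_of_g_small {p₀ : ℕ} {M₀ A₁ v lam₀ T : ℝ} (nB : ℕ) (hM₀ : 0 < M₀) (hA₁ : 0 < A₁) (hv : 0 < v)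
    (h0 : 0 < lam₀) (hp₀ : 1 ≤ p₀) :
    ∃ g₀ : ℝ, 0 < g₀ ∧ ∀ g : ℝ, 0 < g → g ≤ g₀ →
      Real.log (2 * nB) + T * (Real.log (g ^ 2)⁻¹) ^ p₀ ≤
        lam₀ ^ 2 * (M₀ * p0Profile A₁ p₀ g) ^ 2 / (2 * v) := by
  set K : ℝ := lam₀ ^ 2 * M₀ ^ 2 * A₁ ^ 2 / (2 * v) with hKdef
  have hK : 0 < K := by positivity
  set W : ℝ := max (Real.log (2 * nB)) 0 + T with hWdef
  set ℓ₀ : ℝ := max 1 (W / K) with hℓ₀def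
  refine ⟨Real.exp (-(ℓ₀ / 2)), Real.exp_pos _, fun g hg0 hg => ?_⟩
  set ℓ : ℝ := Real.log (g ^ 2)⁻¹ with hℓdef
  have hℓ : ℓ₀ ≤ ℓ := B16Sect1SmallFactors.ell_ge_of_g_le hg0 hg
  have hℓ1 : 1 ≤ ℓ := le_trans (le_max_left _ _) hℓ
  have hp : p₀ < 2 * p₀ := by omega
  have hmain : W * ℓ ^ p₀ ≤ K * ℓ ^ (2 * p₀) := powClause_of_ell_ge hK hp hℓ
  have hℓp : 1 ≤ ℓ ^ p₀ := one_le_pow₀ hℓ1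
  have hlog : Real.log (2 * nB) ≤ max (Real.log (2 * nB)) 0 * ℓ ^ p₀ := by
    calc Real.log (2 * nB) ≤ max (Real.log (2 * nB)) 0 := le_max_left _ _
      _ = max (Real.log (2 * nB)) 0 * 1 := (mul_one _).symm
      _ ≤ max (Real.log (2 * nB)) 0 * ℓ ^ p₀ := mul_le_mul_of_nonneg_left hℓp (le_max_right _ _)
  have hsq : lam₀ ^ 2 * (M₀ * p0Profile A₁ p₀ g) ^ 2 / (2 * v) = K * ℓ ^ (2 * p₀) := by
    rw [hKdef, p0Profile, ← hℓdef, mul_pow, mul_pow, ← pow_mul]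
    ring
  calc Real.log (2 * nB) + T * ℓ ^ p₀ ≤ max (Real.log (2 * nB)) 0 * ℓ ^ p₀ + T * ℓ ^ p₀ := by linarith
    _ = W * ℓ ^ p₀ := by rw [hWdef]; ring
    _ ≤ K * ℓ ^ (2 * p₀) := hmain
    _ = lam₀ ^ 2 * (M₀ * p0Profile A₁ p₀ g) ^ 2 / (2 * v) := hsq.symm

/-! ## §4. The joint clause: road (δ)'s located «g small» conditions below ONE `g⋆(λ₀; print's constants)` -/

/-- **HEADLINE — ROAD (δ)'S LOCATED CLAUSES HOLD JOINTLY, «γ SUFFICIENTLY SMALL» LAST.**  Fix, in print's order: the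
blocking factor `L ≥ 1` and (2.5)'s exponent `r₀`; the profile exponents `p₀ ≥ 1`, `p₁ ≤ p₀` ([B15] p. 183) with the STRICT
proviso of [B16] p. 383 «2p₁ − (d + 5)r₀ > p₀»; the amplitudes `A₀, A₁ > 0` of (2.2)–(2.4) [III], `γ₀ > 0` and the profile
amplitude `A_p > 0` of the p. 381 clause; the cost constant `C′ ≥ 0` (print's `O(1)` of (1.80), under the C8 Jacobian
bookkeeping shifted by `k·log λ₀⁻¹`), `M ≥ 0`, the p. 385 cost `W ≥ 0` and bracket `K_c > 0`, the (1.88) overshoot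
`E₁ ≥ 0` and `β₀ ≥ 0`; the restriction data `M₀ > 0`, `v > 0`, `n_B`, `T`; and road (δ)'s slack `λ₀ > 0` (on which
`C′`, `W`, `E₁` may depend).  THEN there is ONE `g⋆ > 0` such that for every coupling `0 < g ≦ g⋆`:
(i) [B16] p. 381: `4 ≦ γ₀(λ₀A₁)²·A_p(log g⁻²)^{p₀}` — the clause `hsmall` of p340750's `fundamentalFactor_le_live`;
(ii) [B16] p. 383: for every `R` by (2.5) and EVERY live factor `μ ≥ λ₀`,
  `exp(−R^{−d−5}(μ·p₁(g))²) ≦ exp(−p₀(g))` — p340750's `liveFactor383_of_g_small`;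
(iii) [B16] p. 385: for every `R` by (2.5), `2·W·R^{d+2} ≦ K_c(λ₀A₁)²p₀²(g)` — p342544's `locatedCondition385_of_g_small`
  (room `(d + 2)r₀ < 2p₀` from `exponentRoom_of_proviso383`), the input `hcond₀` of `controls_ofIndex_live` ∕
  `fundIneq189_ofIndex_live` up to the consumer's choice `W = 10·126^d·C′M^dL^{d+1}`, `K_c = ¼γ₀(14^d)⁻¹`;
(iv) [B16] p. 387: for every `R` by (2.5), `E₁R^{d+2} + C′M^dR^{d+1}·2 ≦ 2(1+β₀)⁻¹p₀(g)` — `budget188_of_g_small`;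
(v) the tail clause `log(2n_B) + T(log g⁻²)^{p₀} ≦ λ₀²(M₀·A₁(log g⁻²)^{p₀})²∕(2v)` — `tailClause_of_g_small`, the input
  `hclause` of p340806's `restrictedMass_lower_live` and p342610's `restrictedMean_mismatch_live`.
Every symbol except `g` is quantified BEFORE `g⋆`; no clause asks `g` large; `λ₀` is constrained by `0 < λ₀` only.
CONDITIONAL on nothing but its displayed binders; nothing PRINTED is asserted; INSTANCE of NE7c still 0∕1. [folklore] -/
theorem roadDelta_clauses_of_g_small {L r p₀ p₁ d nB : ℕ}
    {A₀ A₁ γ₀ Ap C' M W Kc E₁ β₀ M₀ v T lam₀ : ℝ}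
    (hL : 1 ≤ L) (hp₀ : 1 ≤ p₀) (hp : p₁ ≤ p₀) (hprov : ExponentProviso383 p₀ p₁ r d)
    (hA₀ : 0 < A₀) (hA₁ : 0 < A₁) (hγ : 0 < γ₀) (hAp : 0 < Ap)
    (hC : 0 ≤ C') (hM : 0 ≤ M) (hW : 0 ≤ W) (hKc : 0 < Kc) (hE : 0 ≤ E₁) (hβ : 0 ≤ β₀)
    (hM₀ : 0 < M₀) (hv : 0 < v) (h0 : 0 < lam₀) :
    ∃ gstar : ℝ, 0 < gstar ∧ ∀ g : ℝ, 0 < g → g ≤ gstar →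
      (4 ≤ γ₀ * (lam₀ * A₁) ^ 2 * p0Profile Ap p₀ g) ∧
      (∀ (μ : ℝ) (R : ℕ), B14.IsRj L r g R → lam₀ ≤ μ →
        Real.exp (-((((R : ℝ) ^ (d + 5))⁻¹) * (μ * p0Profile A₁ p₁ g) ^ 2)) ≤
          Real.exp (-p0Profile A₀ p₀ g)) ∧
      (∀ R : ℕ, B14.IsRj L r g R →
        2 * (W * (R : ℝ) ^ (d + 2)) ≤ Kc * (lam₀ * A₁) ^ 2 * (p0Profile A₀ p₀ g) ^ 2) ∧
      (∀ R : ℕ, B14.IsRj L r g R →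
        E₁ * (R : ℝ) ^ (d + 2) + C' * M ^ d * (R : ℝ) ^ (d + 1) * 2 ≤ 2 * (1 + β₀)⁻¹ * p0Profile A₀ p₀ g) ∧
      (Real.log (2 * nB) + T * (Real.log (g ^ 2)⁻¹) ^ p₀ ≤
        lam₀ ^ 2 * (M₀ * p0Profile A₁ p₀ g) ^ 2 / (2 * v)) := by
  -- (i) p. 381: the companion's `clause_of_g_small` with `c = 4`, `K = γ₀`, `A′ = A₁`, `A = A_p`
  set g₁ : ℝ := Real.exp (-(max 1 (4 / (γ₀ * (lam₀ * A₁) ^ 2 * Ap)) / 2)) with hg₁def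
  have hg₁ : 0 < g₁ := Real.exp_pos _
  -- (ii) p. 383
  obtain ⟨g₂, hg₂, h₂⟩ := liveFactor383_of_g_small (p₀ := p₀) (p₁ := p₁) (r := r) (d := d) hL hA₀ hA₁ h0 hprov
  -- (iii) p. 385
  obtain ⟨g₃, hg₃, h₃⟩ := locatedCondition385_of_g_small (n := d + 2) (p₀ := p₀) hL hW hKc hA₀ hA₁ h0
    (exponentRoom_of_proviso383 hprov hp)
  -- (iv) p. 387
  obtain ⟨g₄, hg₄, h₄⟩ := budget188_of_g_small (E₁ := E₁) (C' := C') (M := M) hL hE hC hM hA₀ hβ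
    (budgetRoom_of_proviso383 hprov hp)
  -- (v) the tail clause
  obtain ⟨g₅, hg₅, h₅⟩ := tailClause_of_g_small (p₀ := p₀) (T := T) nB hM₀ hA₁ hv h0 hp₀
  refine ⟨min g₁ (min g₂ (min g₃ (min g₄ g₅))), lt_min hg₁ (lt_min hg₂ (lt_min hg₃ (lt_min hg₄ hg₅))),
    fun g hg0 hg => ?_⟩
  obtain ⟨hle₁, hg'⟩ := le_min_iff.1 hg
  obtain ⟨hle₂, hg''⟩ := le_min_iff.1 hg'
  obtain ⟨hle₃, hg'''⟩ := le_min_iff.1 hg''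
  obtain ⟨hle₄, hle₅⟩ := le_min_iff.1 hg'''
  refine ⟨?_, fun μ R hR hμ => h₂ g μ R hg0 hle₂ hR hμ, fun R hR => h₃ g R hg0 hle₃ hR,
    fun R hR => h₄ g R hg0 hle₄ hR, h₅ g hg0 hle₅⟩
  exact clause_of_g_small (c := 4) hγ hAp hA₁.ne' h0 hp₀ hg0 (by rw [hg₁def] at hle₁; exact hle₁)

/-! ## §5. Sanity -/

/-- SANITY: the binder list of the headline is jointly inhabited — `d = 4`, `p₀ = p₁ = 10`, `r₀ = 1` (proviso
`10 < 20 − 9`), all amplitudes ∕ constants `1`, no cost (`C′ = W = E₁ = 0`), slack `λ₀ = 1∕2`: a `g⋆ > 0` exists.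
[folklore] -/
example : ∃ gstar : ℝ, 0 < gstar ∧ ∀ g : ℝ, 0 < g → g ≤ gstar →
    (4 ≤ (1 : ℝ) * ((1 / 2 : ℝ) * 1) ^ 2 * p0Profile 1 10 g) ∧
    (∀ (μ : ℝ) (R : ℕ), B14.IsRj 2 1 g R → (1 / 2 : ℝ) ≤ μ →
      Real.exp (-((((R : ℝ) ^ (4 + 5))⁻¹) * (μ * p0Profile 1 10 g) ^ 2)) ≤ Real.exp (-p0Profile 1 10 g)) ∧
    (∀ R : ℕ, B14.IsRj 2 1 g R →
      2 * ((0 : ℝ) * (R : ℝ) ^ (4 + 2)) ≤ (1 : ℝ) * ((1 / 2 : ℝ) * 1) ^ 2 * (p0Profile 1 10 g) ^ 2) ∧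
    (∀ R : ℕ, B14.IsRj 2 1 g R →
      (0 : ℝ) * (R : ℝ) ^ (4 + 2) + (0 : ℝ) * (1 : ℝ) ^ 4 * (R : ℝ) ^ (4 + 1) * 2 ≤
        2 * (1 + (0 : ℝ))⁻¹ * p0Profile 1 10 g) ∧
    (Real.log (2 * (1 : ℕ)) + (1 : ℝ) * (Real.log (g ^ 2)⁻¹) ^ 10 ≤
      (1 / 2 : ℝ) ^ 2 * ((1 : ℝ) * p0Profile 1 10 g) ^ 2 / (2 * 1)) :=
  roadDelta_clauses_of_g_small (L := 2) (r := 1) (p₀ := 10) (p₁ := 10) (d := 4) (nB := 1) (by norm_num)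
    (by norm_num) le_rfl (by unfold ExponentProviso383; norm_num) one_pos one_pos one_pos one_pos le_rfl
    zero_le_one le_rfl one_pos le_rfl le_rfl one_pos one_pos (by norm_num)

end

end Summit.QuantumFields.BalabanUV.T4Continuum.Spine.NE7c.LiveFactorJointClause
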